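import Summits.QuantumFields.YangMills.Theorems.FluctuationComparisonRegPrIntLS2BetaOrbitGrowthOfRegular
import Summits.QuantumFields.YangMills.Theorems.ConvexGribovBodyBrascampLiebVacuumSCDimensionGapSU2
import Summits.QuantumFields.YangMills.Theorems.FluctuationComparisonRegPrIntLS2BetaResidualGaugeOrbit
import HarnessLib

/-!
# S2β · organ GAP♯∘ ∕ ORB — **[Balaban1985Variational] PROP. 7 CLAUSE 1 (at most one critical orbit in (6)) FROM ORBIT GROWTH: ZERO ANALYTIC HYPOTHESES AT EVERY `L ≥ 5`**;
# the full-gauge edition unconditionally, print's (4)-orbit edition at every datum with central stabiliser (the generic datum) and wherever the datum's symmetries lift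

Cell `ym3-torus` (rung R3 = SU(2) YM₃ on T³ — NOT d = 4, NOT infinite volume, NOT a mass gap, NOT Clay).  Width seat `ym3-torus-px17` (gen 15), FREE px helper of `stmt-QuantumFields-20520`
(`--supports … --as helper`, count-neutral); DEFINITION-FREE (0 `def`∕`instance`∕`notation`∕`sorry`, default heartbeats).

WHY.  The S2ᵝ organ's orbit letters (ORB, ORB̄, ISOL∘; px17 g14 UV3-NODE §37) and px16's flat chain (✓brick 5) display print's uniqueness clause `Prop7AtMostOneCriticalOrbitAt L a₀ B₃`
([Balaban1985Variational] Prop. 7 p.299 «the variational problem (5), (6) has at most one critical orbit»; tree: conditional suppliers only — ✓`Prop7PV3CUniqueness.atMostOneCriticalOrbit_of_A_Cuniq`,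
✓`Prop7FlatRigidity` at flat data).  ✓`…S2BetaOrbitGrowthOfRegular.orbitGrowth_of_isCritR2_five` (✓p797047: (142) with its rate in orbit-`dist1²` currency, zero hypotheses at `L ≥ 5`) makes the
clause a COROLLARY: two R2-critical points `U, U′` of one regular fibre `regFibrePr F n K e V` (`e ≤ e₈(L)`) satisfy `A U ≤ A U′ ≤ A U` (growth both ways), so the growth sum vanishes and
`U′ = u • U` for the representative's gauge `u`; both points lying in the fibre, `(u↓) • V = V` EXACTLY (lit ✓`descendTo_gaugeAct`).  Print's (4)-orbit (`SameOrbit`: `u↓ = 1`) follows when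
`u↓` can be corrected inside the stabilisers: at a datum with CENTRAL stabiliser (`s • V = V ⇒ s = ±1`; the generic, irreducible datum) `−u` is residual and acts like `u`; more generally whenever
the datum's symmetries lift to symmetries of the critical point.
* §1 dictionary (✓`…ResidualGaugeOrbit.eq_one_of_dist1_eq_zero` reused): `eq_of_sum_dist1_sq_eq_zero` (a vanishing orbit-`dist1²` sum forces equality), `negTransf`-rows (`(−u) • U = u • U`, `(−u)↓ = −(u↓)`), `gaugeAct_descTransf_eq_of_mem_fibre` (`u↓ ∈ Stab V`).
* §2 ★★★ `critical_gaugeRelated_five (L) (h5 : 5 ≤ L)` — `∃ e₈ > 0 ∀ F (F.L = L) n<K e V U U′, 0<e≤e₈ → U ∈ regFibrePr e V → IsCritR2 V U → U′ ∈ regFibrePr e V → IsCritR2 V U′ →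
  ∃ u, U′ = u • U ∧ (descTransf u) • V = V` — ANY TWO CRITICAL POINTS OF A REGULAR FIBRE ARE GAUGE-EQUIVALENT, NO HYPOTHESIS.
* §3 ★★★ `atMostOneCriticalOrbit_of_centralStab_five` — at every datum `V` with `∀ s, s • V = V → s = 1 ∨ s = negTransf 1`: `(varProblem3 F n K h).AtMostOneCriticalOrbit e V`
  for `0 < e ≤ e₈(L)`, NO analytic hypothesis; ★★ `sameOrbit_of_symmetriesLift_five` — the same conclusion for a pair whose datum symmetries lift (`∀ s, s • V = V → ∃ k, k • U = U ∧ k↓ = s`).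
RESIDUE (located): the reducible data whose symmetries do not lift — there print's (4)-orbit uniqueness is EXACTLY the (4)-vs-residual token of the S2ᵝ seam (px8 `…OrbitDistComparison`,
px21 (T6), px13; LEAD R-UNIQ (d)); the window form `Prop7AtMostOneCriticalOrbitAt L a₀ B₃` (ALL `PlaqSmall ε₁` data) is therefore NOT claimed.
HONEST SCOPE.  Compositions of landed theorems + finite group bookkeeping; nothing of Bałaban's analysis asserted beyond the cited tree theorems; credits nothing; Prop. 7 cl.1 at reducible data,
ORB̄∕ISOL∘∕REG-ARGMIN̄, GAP♯∘, EXW∘, 20520, `YM3TorusSU2` NOT proved; at `L = 3` the Thm-2 socket is open (EMBARGO-LITE №58).  The Yang–Mills mass gap is NOT proved.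
References: T. Bałaban, CMP **102** (1985) 277–309 [Balaban1985Variational] ((4)–(6) p.278, Prop. 7 p.299, (141)–(143) p.299); CMP **99** (1985) 75–102 [Balaban1985RegularSpaces] (Thm 2 p.83);
CMP **98** (1985) 17–51 [Balaban1985Averaging] ((8) p.19, (11)–(13) p.19).
-/

set_option autoImplicit false
noncomputable section

open scoped BigOperators Matrix.Norms.L2Operator Matrix

namespace Summit.QuantumFields.YangMills.Theorems.FluctuationComparisonRegPrIntLS2BetaCriticalOrbitUnique

open Literature.MathematicalPhysics.QuantumFieldTheory.Balaban1983to89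
open Literature.MathematicalPhysics.QuantumFieldTheory.Balaban1983to89.T3ContinuumYM3Torus
open Literature.MathematicalPhysics.QuantumFieldTheory.Balaban1983to89.T3UnitLawDensityEML (ℰp)
open Literature.MathematicalPhysics.QuantumFieldTheory.Balaban1983to89.T3ConstrainedMinimiser (fibre)
open Literature.MathematicalPhysics.QuantumFieldTheory.Balaban1983to89.T3TiltDescent (descendTo)
open Literature.MathematicalPhysics.QuantumFieldTheory.Balaban1983to89.T3PrintedRegularMinimiser
open Literature.MathematicalPhysics.QuantumFieldTheory.Balaban1983to89.T3PrintedRegularOrbits (descTransf descendTo_gaugeAct)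
open Literature.MathematicalPhysics.QuantumFieldTheory.Balaban1983to89.T3Thm1Carrier (SameOrbit varProblem3)
open Literature.MathematicalPhysics.QuantumFieldTheory.Balaban1983to89.T3Thm1CarrierNative (IsCritR2)
open T4Continuum (transfUp)
open Summit.QuantumFields.YangMills.Theorems.FluctuationComparisonRegPrIntLS2BetaOrbitGrowthOfRegular (orbitGrowth_of_isCritR2_five)
open Summit.QuantumFields.YangMills.Theorems.BrascampLiebVacuumSC.DimensionGapSU2 (neg_one_mem)
open Summit.QuantumFields.YangMills.Theorems.FluctuationComparisonRegPrIntLS2BetaResidualGaugeOrbit (eq_one_of_dist1_eq_zero)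

/-! ## §1 Dictionary -/

section Dict

variable {F : T3Family} {n K : ℕ}

/-- A vanishing orbit-`dist1²` sum forces bondwise equality: `Σ_ℓ dist1(W′ ℓ·(X ℓ)⁻¹)² = 0 ⇒ W′ = X`. [folklore] -/
theorem eq_of_sum_dist1_sq_eq_zero {W' X : GaugeField (F.P K) 0 (Matrix.specialUnitaryGroup (Fin 2) ℂ)}
    (h : ∑ ℓ : PBond (F.P K) 0, dist1 (W' ℓ * (X ℓ)⁻¹) ^ 2 = 0) : W' = X := by
  have hz := (Finset.sum_eq_zero_iff_of_nonneg (fun ℓ _ => sq_nonneg (dist1 (W' ℓ * (X ℓ)⁻¹)))).mp h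
  funext ℓ
  have h1 : dist1 (W' ℓ * (X ℓ)⁻¹) = 0 := pow_eq_zero_iff (n := 2) (by norm_num) |>.mp (hz ℓ (Finset.mem_univ ℓ))
  have h2 := eq_one_of_dist1_eq_zero _ h1
  exact mul_inv_eq_one.mp h2

/-- The central element `−1` of `SU(2)` as a constant gauge transformation factor: `x ↦ (−1)·u(x)`. [folklore] -/
theorem negOne_mul_comm (g : Matrix.specialUnitaryGroup (Fin 2) ℂ) :
    (⟨-1, neg_one_mem⟩ : Matrix.specialUnitaryGroup (Fin 2) ℂ) * g = g * ⟨-1, neg_one_mem⟩ := by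
  apply Subtype.ext
  change (-1 : Matrix (Fin 2) (Fin 2) ℂ) * (g : Matrix (Fin 2) (Fin 2) ℂ) = (g : Matrix (Fin 2) (Fin 2) ℂ) * (-1)
  rw [neg_one_mul, mul_neg_one]

/-- `(−1)·(−1) = 1` in `SU(2)`. [folklore] -/
theorem negOne_mul_negOne : (⟨-1, neg_one_mem⟩ : Matrix.specialUnitaryGroup (Fin 2) ℂ) * ⟨-1, neg_one_mem⟩ = 1 := by
  apply Subtype.ext
  change (-1 : Matrix (Fin 2) (Fin 2) ℂ) * (-1) = 1
  rw [neg_one_mul, neg_neg]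

/-- A central involution cancels in a gauge-type conjugation: `(c·x)·y·(c·z)⁻¹ = x·y·z⁻¹`. [folklore] -/
theorem central_conj_cancel {G : Type*} [Group G] (c x y z : G) (key : ∀ a : G, c * a = a * c) (h2 : c * c = 1) :
    c * x * y * (c * z)⁻¹ = x * y * z⁻¹ := by
  have hc : c⁻¹ = c := inv_eq_of_mul_eq_one_right h2
  rw [mul_inv_rev, hc]
  calc c * x * y * (z⁻¹ * c) = (c * (x * y * z⁻¹)) * c := by simp only [mul_assoc]
    _ = (x * y * z⁻¹) * c * c := by rw [key]
    _ = x * y * z⁻¹ := by rw [mul_assoc, h2, mul_one]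

/-- `(−u) • U = u • U`: the central factor cancels bondwise. [cite: Balaban1985Averaging, (8) p.19] -/
theorem gaugeAct_negOne_mul (u : GaugeTransf (F.P K) 0 (Matrix.specialUnitaryGroup (Fin 2) ℂ)) (U : GaugeField (F.P K) 0 (Matrix.specialUnitaryGroup (Fin 2) ℂ)) :
    GaugeField.gaugeAct (fun x => (⟨-1, neg_one_mem⟩ : Matrix.specialUnitaryGroup (Fin 2) ℂ) * u x) U = GaugeField.gaugeAct u U := by
  funext b
  show (⟨-1, neg_one_mem⟩ : Matrix.specialUnitaryGroup (Fin 2) ℂ) * u b.src * U b * ((⟨-1, neg_one_mem⟩ : Matrix.specialUnitaryGroup (Fin 2) ℂ) * u b.tgt)⁻¹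
    = u b.src * U b * (u b.tgt)⁻¹
  exact central_conj_cancel _ _ _ _ negOne_mul_comm negOne_mul_negOne

/-- Restriction up the centres commutes with a constant left factor: `(c·u)^{(k)} = c·u^{(k)}`. [cite: Balaban1985Averaging, (11)-(13) p.19] -/
theorem transfUp_const_mul {P : Params} {G : Type*} [GaugeGroup G] (c : G) (u : GaugeTransf P 0 G) :
    ∀ (k : ℕ) (y : Site P k), transfUp (fun x => c * u x) k y = c * transfUp u k y
  | 0, _ => rfl
  | k + 1, _ => transfUp_const_mul c u k _

/-- `(c·u)↓ = c·(u↓)` for the descended transformation of record. [cite: Balaban1985Averaging, (12)-(13) p.19] -/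
theorem descTransf_const_mul (h : n ≤ K) (c : Matrix.specialUnitaryGroup (Fin 2) ℂ) (u : GaugeTransf (F.P K) 0 (Matrix.specialUnitaryGroup (Fin 2) ℂ)) :
    descTransf F n K h (fun x => c * u x) = fun y => c * descTransf F n K h u y := by
  funext y
  exact transfUp_const_mul c u (K - n) _

/-- Restriction up the centres is multiplicative with inverses: `(u·k⁻¹)^{(j)} = u^{(j)}·(k^{(j)})⁻¹`. [cite: Balaban1985Averaging, (11)-(13) p.19] -/
theorem transfUp_mul_inv {P : Params} {G : Type*} [GaugeGroup G] (u k : GaugeTransf P 0 G) :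
    ∀ (j : ℕ) (y : Site P j), transfUp (fun x => u x * (k x)⁻¹) j y = transfUp u j y * (transfUp k j y)⁻¹
  | 0, _ => rfl
  | j + 1, _ => transfUp_mul_inv u k j _

/-- `(u·k⁻¹)↓ = u↓·(k↓)⁻¹`. [cite: Balaban1985Averaging, (12)-(13) p.19] -/
theorem descTransf_mul_inv (h : n ≤ K) (u k : GaugeTransf (F.P K) 0 (Matrix.specialUnitaryGroup (Fin 2) ℂ)) :
    descTransf F n K h (fun x => u x * (k x)⁻¹) = fun y => descTransf F n K h u y * (descTransf F n K h k y)⁻¹ := by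
  funext y
  exact transfUp_mul_inv u k (K - n) _

/-- **Two points of one fibre related by a gauge transformation: the descended transformation STABILISES the datum, exactly** (covariance ✓`descendTo_gaugeAct`).
[cite: Balaban1985Variational, (3)-(4) p.278; Balaban1985Averaging, (11) p.19] -/
theorem gaugeAct_descTransf_eq_of_mem_fibre (h : n ≤ K) {V : GaugeField (F.P n) 0 (Matrix.specialUnitaryGroup (Fin 2) ℂ)}
    {U U' : GaugeField (F.P K) 0 (Matrix.specialUnitaryGroup (Fin 2) ℂ)} (u : GaugeTransf (F.P K) 0 (Matrix.specialUnitaryGroup (Fin 2) ℂ))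
    (hU : U ∈ fibre F ℰp n K h V) (hU' : U' ∈ fibre F ℰp n K h V) (hrel : U' = GaugeField.gaugeAct u U) :
    GaugeField.gaugeAct (descTransf F n K h u) V = V := by
  have h1 : descendTo F ℰp n K h U' = V := hU'
  have h0 : descendTo F ℰp n K h U = V := hU
  rw [hrel, descendTo_gaugeAct, h0] at h1
  exact h1

end Dict

/-! ## §2 Any two critical points of a regular fibre are gauge-equivalent (ZERO hypotheses, L ≥ 5) -/

/-- ★★★ **[Balaban1985Variational] PROP. 7 CLAUSE 1, FULL-GAUGE EDITION, NO HYPOTHESIS AT EVERY `L ≥ 5`.**  For every block size `L ≥ 5` there is `e₈ > 0` such that at every member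
`(F, n < K)`, every datum `V` and every `0 < e ≤ e₈`: two R2-critical points `U, U′ ∈ regFibrePr F n K e V` (each a minimiser of the Wilson action over some regular fibre over `V`) are
gauge-equivalent, `U′ = u • U`, and the descended transformation stabilises the datum exactly, `(u↓) • V = V`.  Proof: ✓`orbitGrowth_of_isCritR2_five` both ways ⇒ equal actions ⇒ the
growth sum vanishes ⇒ §1. [cite: Balaban1985Variational, Prop. 7 p.299, (141)-(143) p.299, (4)-(6) p.278] -/
theorem critical_gaugeRelated_five (L : ℕ) (h5 : 5 ≤ L) :
    ∃ e₈ : ℝ, 0 < e₈ ∧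
      ∀ (F : T3Family), F.L = L → ∀ (n K : ℕ) (hnK : n < K) (e : ℝ) (V : GaugeField (F.P n) 0 (Matrix.specialUnitaryGroup (Fin 2) ℂ))
        (U U' : GaugeField (F.P K) 0 (Matrix.specialUnitaryGroup (Fin 2) ℂ)),
        0 < e → e ≤ e₈ → U ∈ regFibrePr F n K hnK.le e V → IsCritR2 F n K hnK.le V U → U' ∈ regFibrePr F n K hnK.le e V → IsCritR2 F n K hnK.le V U' →
          ∃ u : GaugeTransf (F.P K) 0 (Matrix.specialUnitaryGroup (Fin 2) ℂ),
            U' = GaugeField.gaugeAct u U ∧ GaugeField.gaugeAct (descTransf F n K hnK.le u) V = V := by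
  obtain ⟨e₈, c, he₈, hc, H⟩ := orbitGrowth_of_isCritR2_five L h5
  refine ⟨e₈, he₈, ?_⟩
  intro F hF n K hnK e V U U' he heε hU hcU hU' hcU'
  obtain ⟨u, hu⟩ := H F hF n K hnK e V U he heε hU hcU U' hU'
  obtain ⟨u', hu'⟩ := H F hF n K hnK e V U' he heε hU' hcU' U hU
  have hℓ : (0 : ℝ) < c * (((F.L : ℝ) ^ (K - n)) ^ 2)⁻¹ := by
    have hL : (0 : ℝ) < (F.L : ℝ) := by have := F.hL.2; exact_mod_cast (by omega : 0 < F.L)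
    positivity
  have hS0 : 0 ≤ ∑ ℓ : PBond (F.P K) 0, dist1 (U' ℓ * ((GaugeField.gaugeAct u U) ℓ)⁻¹) ^ 2 := Finset.sum_nonneg fun _ _ => sq_nonneg _
  have hS0' : 0 ≤ ∑ ℓ : PBond (F.P K) 0, dist1 (U ℓ * ((GaugeField.gaugeAct u' U') ℓ)⁻¹) ^ 2 := Finset.sum_nonneg fun _ _ => sq_nonneg _
  -- equal actions
  have hA : wilsonAction4 U' = wilsonAction4 U := by
    have h1 : 0 ≤ wilsonAction4 U' - wilsonAction4 U := (mul_nonneg hℓ.le hS0).trans hu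
    have h2 : 0 ≤ wilsonAction4 U - wilsonAction4 U' := (mul_nonneg hℓ.le hS0').trans hu'
    linarith
  have hsum : ∑ ℓ : PBond (F.P K) 0, dist1 (U' ℓ * ((GaugeField.gaugeAct u U) ℓ)⁻¹) ^ 2 = 0 := by
    have h1 : c * (((F.L : ℝ) ^ (K - n)) ^ 2)⁻¹ * ∑ ℓ : PBond (F.P K) 0, dist1 (U' ℓ * ((GaugeField.gaugeAct u U) ℓ)⁻¹) ^ 2 ≤ 0 := by
      rw [hA, sub_self] at hu; exact hu
    have h2 : ∑ ℓ : PBond (F.P K) 0, dist1 (U' ℓ * ((GaugeField.gaugeAct u U) ℓ)⁻¹) ^ 2 ≤ 0 := by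
      by_contra hne
      push Not at hne
      have := mul_pos hℓ hne
      linarith
    exact le_antisymm h2 hS0
  have hrel := eq_of_sum_dist1_sq_eq_zero hsum
  refine ⟨u, hrel, ?_⟩
  exact gaugeAct_descTransf_eq_of_mem_fibre hnK.le u ((mem_regFibrePr_iff F).mp hU).1 ((mem_regFibrePr_iff F).mp hU').1 hrel

/-! ## §3 Print's (4)-orbit at data with central stabiliser, and wherever the datum's symmetries lift -/

/-- ★★★ **PROP. 7 CLAUSE 1 IN PRINT's LETTERS AT EVERY DATUM WITH CENTRAL STABILISER — NO ANALYTIC HYPOTHESIS, `L ≥ 5`.**  If every gauge transformation of the comparison lattice fixing `V` is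
`1` or `−1` (the generic, irreducible datum), then `(varProblem3 F n K h).AtMostOneCriticalOrbit e V` for `0 < e ≤ e₈(L)`: any two R2-critical points of `(6)(e) ∩ 𝔅_k(V)` lie on ONE orbit of
print's group (4) (`SameOrbit`: a transformation with `u↓ = 1`).  Proof: §2 gives `U′ = u • U` with `u↓ ∈ Stab V = {1, −1}`; if `u↓ = −1`, replace `u` by `(−1)·u` (§1: same action on fields,
`((−1)·u)↓ = (−1)·(u↓) = 1`). [cite: Balaban1985Variational, Prop. 7 p.299, (4) p.278] -/
theorem atMostOneCriticalOrbit_of_centralStab_five (L : ℕ) (h5 : 5 ≤ L) :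
    ∃ e₈ : ℝ, 0 < e₈ ∧
      ∀ (F : T3Family), F.L = L → ∀ (n K : ℕ) (hnK : n < K) (e : ℝ) (V : GaugeField (F.P n) 0 (Matrix.specialUnitaryGroup (Fin 2) ℂ)),
        0 < e → e ≤ e₈ →
        (∀ s : GaugeTransf (F.P n) 0 (Matrix.specialUnitaryGroup (Fin 2) ℂ), GaugeField.gaugeAct s V = V →
            s = (fun _ => 1) ∨ s = (fun _ => (⟨-1, neg_one_mem⟩ : Matrix.specialUnitaryGroup (Fin 2) ℂ))) →
          (varProblem3 F n K hnK.le).AtMostOneCriticalOrbit e V := by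
  obtain ⟨e₈, he₈, H⟩ := critical_gaugeRelated_five L h5
  refine ⟨e₈, he₈, ?_⟩
  intro F hF n K hnK e V he heε hstab U U' hUreg hUfib hUcrit hU'reg hU'fib hU'crit
  have hU : U ∈ regFibrePr F n K hnK.le e V := (mem_regFibrePr_iff F).mpr ⟨hUfib, hUreg⟩
  have hU' : U' ∈ regFibrePr F n K hnK.le e V := (mem_regFibrePr_iff F).mpr ⟨hU'fib, hU'reg⟩
  obtain ⟨u, hrel, hfix⟩ := H F hF n K hnK e V U U' he heε hU hUcrit hU' hU'crit
  rcases hstab (descTransf F n K hnK.le u) hfix with h1 | hm1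
  · exact ⟨u, h1, hrel⟩
  · refine ⟨fun x => (⟨-1, neg_one_mem⟩ : Matrix.specialUnitaryGroup (Fin 2) ℂ) * u x, ?_, ?_⟩
    · rw [descTransf_const_mul, hm1]
      funext y
      exact negOne_mul_negOne
    · rw [gaugeAct_negOne_mul]; exact hrel

/-- ★★ **THE GENERAL CRITERION: wherever the datum's symmetries lift to the critical point.**  For the `e₈(L)` of §2 and two R2-critical points `U, U′ ∈ regFibrePr F n K e V`: if every `s` with
`s • V = V` is the descent of some `k` fixing `U` (`k • U = U`, `k↓ = s`), then `SameOrbit U U′` (print's (4)-orbit).  Covers the central-stabiliser data (`k := ±1`) and e.g. the flat datum.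
[cite: Balaban1985Variational, Prop. 7 p.299, (4) p.278] -/
theorem sameOrbit_of_symmetriesLift_five (L : ℕ) (h5 : 5 ≤ L) :
    ∃ e₈ : ℝ, 0 < e₈ ∧
      ∀ (F : T3Family), F.L = L → ∀ (n K : ℕ) (hnK : n < K) (e : ℝ) (V : GaugeField (F.P n) 0 (Matrix.specialUnitaryGroup (Fin 2) ℂ))
        (U U' : GaugeField (F.P K) 0 (Matrix.specialUnitaryGroup (Fin 2) ℂ)),
        0 < e → e ≤ e₈ → U ∈ regFibrePr F n K hnK.le e V → IsCritR2 F n K hnK.le V U → U' ∈ regFibrePr F n K hnK.le e V → IsCritR2 F n K hnK.le V U' →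
        (∀ s : GaugeTransf (F.P n) 0 (Matrix.specialUnitaryGroup (Fin 2) ℂ), GaugeField.gaugeAct s V = V →
            ∃ k : GaugeTransf (F.P K) 0 (Matrix.specialUnitaryGroup (Fin 2) ℂ), GaugeField.gaugeAct k U = U ∧ descTransf F n K hnK.le k = s) →
          SameOrbit F n K hnK.le U U' := by
  obtain ⟨e₈, he₈, H⟩ := critical_gaugeRelated_five L h5
  refine ⟨e₈, he₈, ?_⟩
  intro F hF n K hnK e V U U' he heε hU hcU hU' hcU' hlift
  obtain ⟨u, hrel, hfix⟩ := H F hF n K hnK e V U U' he heε hU hcU hU' hcU'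
  obtain ⟨k, hkU, hk⟩ := hlift (descTransf F n K hnK.le u) hfix
  -- `w := u · k⁻¹` is residual (`w↓ = u↓ · (k↓)⁻¹ = 1`) and `w • U = u • (k⁻¹-twist of U) = u • U = U′`
  refine ⟨fun x => u x * (k x)⁻¹, ?_, ?_⟩
  · rw [descTransf_mul_inv, hk]
    funext y
    exact mul_inv_cancel _
  · rw [hrel]
    funext b
    have hkb : k b.src * U b * (k b.tgt)⁻¹ = U b := congrFun hkU b
    show u b.src * U b * (u b.tgt)⁻¹ = u b.src * (k b.src)⁻¹ * U b * (u b.tgt * (k b.tgt)⁻¹)⁻¹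
    have hinv : (k b.src)⁻¹ * U b * k b.tgt = U b := by
      calc (k b.src)⁻¹ * U b * k b.tgt = (k b.src)⁻¹ * (k b.src * U b * (k b.tgt)⁻¹) * k b.tgt := by rw [hkb]
        _ = U b := by group
    calc u b.src * U b * (u b.tgt)⁻¹ = u b.src * ((k b.src)⁻¹ * U b * k b.tgt) * (u b.tgt)⁻¹ := by rw [hinv]
      _ = u b.src * (k b.src)⁻¹ * U b * (u b.tgt * (k b.tgt)⁻¹)⁻¹ := by group

end Summit.QuantumFields.YangMills.Theorems.FluctuationComparisonRegPrIntLS2BetaCriticalOrbitUnique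

end
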